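import Mathlib
import HarnessLib
import Summits.HubbardSuperconductivity.HubbardSuperconductivity.Theses.ChiralWindow
import Summits.HubbardSuperconductivity.HubbardSuperconductivity.Theorems.ChiralWindowCwChiralConstructionResidual
import Summits.HubbardSuperconductivity.HubbardSuperconductivity.Theorems.ChiralWindowCwChannelInfContinuousFilling
import Summits.HubbardSuperconductivity.HubbardSuperconductivity.Theorems.ChiralWindowCwChannelInfContinuousChemicalPotential
import Summits.HubbardSuperconductivity.HubbardSuperconductivity.Theorems.ChiralWindowCwChiralConstructionKLWindowOfPoint
import Summits.HubbardSuperconductivity.HubbardSuperconductivity.Theorems.ChiralWindowCwChiralConstructionFillingAtNegThreeTenths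

/-!
# Crux `CwChiralConstruction` (stmt-HubbardSuperconductivity-1740): the crux from the kill switch and the
# Kohn–Luttinger mechanism (record-free conditional bridge)

Route `HubbardSuperconductivity/ChiralWindow`, rank-2 crux ("the programme"). Support file
(`--supports stmt-HubbardSuperconductivity-1740`), line `ladder-scale-transfer` rev c5-2 (lead c5, 2026-08-17).

Write `ε₀ = squareDispersion 1 0`, `Λ_U(μ,χ) = channelInf ε₀ μ U χ`, `n(μ) = KohnLuttinger.filling ε₀ μ`,
`m(U,μ) = dWaveOrderParameter U μ`. The line closes the crux from clause (i) of this route's kill switch `CwKLChiralWindow`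
(stmt-1741: `B₁g` strictly leading, by `γU²`, at ONE window doping) and a research pair (Rloc) + (B) — the symmetric RG
flow to a ladder scale and the broken regime below it — whose COMPOSITE, read without any reference to the RG record, is
the Kohn–Luttinger mechanism in its natural local, uniform form:

  (KL)  for every level window `[μ₁, μ₂] ⊂ [-2, -3/10]` on which `B₁g` leads every other channel of the second-order
        vertex by `γU²` for all `U < U₁`, there are a sub-window `μ₁ ≤ μ₁' < μ₂' ≤ μ₂` and `U₀, C > 0` with
        `e^{-C/U²} ≤ m(U, μ)` for every `U ∈ (0, U₀)` and every `μ ∈ (μ₁', μ₂')`.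

This file proves, record-free: **`CwKLChiralWindow ∧ (KL) ⟹ CwChiralConstruction`**
(`cwChiralConstruction_of_cwKLChiralWindow_of_klMechanism`; registered arrow form
`stub_cruxOfChiralWindowAndKLMechanism`). Chain: clause (i) of the kill switch is the point datum
(`klLeadingAtWindowDoping_of_cwKLChiralWindow'`); the landed `stub_klLeadingMuWindowOfPoint` (p141740) makes a level
window `[μ₁, μ₂]` with certified fillings `13/25 < n(μ₁)`, `n(μ₂) < 7/10` on which `B₁g` leads uniformly in small `U`;
the certified fillings `n(-2) ≤ 1/2` (`filling_neg_two_le_half'`) and `7/10 ≤ n(-3/10)` (`stub_fillingAtNegThreeTenths`,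
p141417) place it inside `[-2, -3/10]` (strictly monotone free filling); (KL) gives the floor on an open sub-window,
whose closure has free fillings in `[13/25 + η, 7/10 - η]` (`monotone_filling`); c1's landed frame
`cwChiralConstruction_of_orderOnOpenSet` (generic-`μ` density, `cw_genericDensity`, p96959) concludes.

So, for the planners: modulo the rank-1 crux stmt-1741 of the SAME route, crux 1740 is EXACTLY conditional on (KL) — a
faithful formal statement of "the Kohn–Luttinger mechanism produces `d_{x²-y²}` order at weak coupling", with the
leading hypothesis explicit (unlike the bare residual `KLOrderOnFillingWindow` of seat c1). (KL) is the open problem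
(barriers `WeakCouplingCeiling`, `PerturbativeInvisibilityOfPairing`); nothing here claims it.

No definitions; everything is proved. [folklore: Kohn–Luttinger 1965; Raghu–Kivelson–Scalapino 2010 §II–III; Griffiths
1964 + the cited tree lemmas]
-/

set_option linter.dupNamespace false

namespace Summit.HubbardSuperconductivity.HubbardSuperconductivity.Theorems

open Literature.MathematicalPhysics.QuantumLattice Filter
open Summit.HubbardSuperconductivity.HubbardSuperconductivity.Theses.ChiralWindow
open scoped Topology

/-- **Clause (i) of the kill switch is the point datum**: `CwKLChiralWindow` gives `δ₀ ∈ [3/10, 12/25]` (namely its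
`a`), `γ, U₁ > 0` with `Λ_U(μ(1-δ₀), B1g) + γU² ≤ Λ_U(μ(1-δ₀), χ)` for every `χ ≠ B1g`, `U ∈ (0, U₁)`.
[cite: RaghuKivelsonScalapino2010, §III Fig. 2] -/
theorem klLeadingAtWindowDoping_of_cwKLChiralWindow' (h : CwKLChiralWindow) :
    ∃ δ₀ ∈ Set.Icc (3/10 : ℝ) (12/25), ∃ γ U₁ : ℝ, 0 < γ ∧ 0 < U₁ ∧ ∀ U ∈ Set.Ioo (0:ℝ) U₁,
      ∀ χ : D4Irrep, χ ≠ D4Irrep.B1g →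
        channelInf (squareDispersion 1 0) (chemicalPotentialOfDensity (squareDispersion 1 0) (1 - δ₀)) U D4Irrep.B1g
            + γ * U ^ 2 ≤
          channelInf (squareDispersion 1 0) (chemicalPotentialOfDensity (squareDispersion 1 0) (1 - δ₀)) U χ := by
  obtain ⟨_, _, _, a, b, γ, _, U₁, ha, hab, hb, hγ, _, hU₁, H⟩ := h
  refine ⟨a, ⟨ha, by linarith⟩, γ, U₁, hγ, hU₁, fun U hU χ hχ => ?_⟩
  obtain ⟨h1, -⟩ := H U hU
  exact h1 χ hχ

/-- **The free filling at `μ = -2` is at most `1/2`** (true value `0.37`): the Fermi sea `{cos x + cos y > 1}` lies in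
the open square `(-π/2, π/2)²` of area `π²`, so `n(-2) = 2·vol/(2π)² ≤ 1/2`. [folklore] -/
theorem filling_neg_two_le_half' : KohnLuttinger.filling (squareDispersion 1 0) (-2) ≤ 1 / 2 := by
  rw [kl_mu_filling_eq]
  have hsub : {p : Momentum | squareDispersion 1 0 p < -2} ∩ brillouinZone ⊆
      {p : Momentum | ∀ i, p i ∈ Set.Ioo (-(Real.pi / 2)) (Real.pi / 2)} := by
    rintro p ⟨hp1, hp2⟩
    simp only [Set.mem_setOf_eq, squareDispersion] at hp1
    have hsum : 1 < Real.cos (p 0) + Real.cos (p 1) := by linarith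
    have habs : ∀ i, |p i| ≤ Real.pi := fun i => by
      have := hp2 i
      rw [abs_le]
      exact ⟨this.1, this.2.le⟩
    have hcos : ∀ i, 0 < Real.cos (p i) := by
      intro i
      fin_cases i
      · have := Real.cos_le_one (p 1); simp; linarith
      · have := Real.cos_le_one (p 0); simp; linarith
    intro i
    have hlt : |p i| < Real.pi / 2 := by
      by_contra hge
      have hge : Real.pi / 2 ≤ |p i| := not_lt.mp hge
      have h1 : Real.cos |p i| ≤ Real.cos (Real.pi / 2) :=
        Real.cos_le_cos_of_nonneg_of_le_pi (by positivity) (habs i) hge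
      rw [Real.cos_abs, Real.cos_pi_div_two] at h1
      linarith [hcos i]
    exact ⟨by linarith [(abs_lt.1 hlt).1], (abs_lt.1 hlt).2⟩
  have hvol : (MeasureTheory.volume ({p : Momentum | squareDispersion 1 0 p < -2} ∩ brillouinZone)).toReal ≤
      Real.pi ^ 2 := by
    refine ENNReal.toReal_le_of_le_ofReal (by positivity) ?_
    exact (MeasureTheory.measure_mono hsub).trans (le_of_eq volume_halfOpenSquare)
  have hπ : 0 < Real.pi := Real.pi_pos
  rw [div_le_iff₀ (by positivity)]
  nlinarith

/-- **The crux from the kill switch and the Kohn–Luttinger mechanism (record-free conditional bridge).**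
`CwKLChiralWindow` (stmt-1741) together with the Kohn–Luttinger mechanism in local uniform form — on every level window
`[μ₁, μ₂] ⊂ [-2, -3/10]` where `B₁g` leads by `γU²` for small `U`, an order floor `e^{-C/U²} ≤ dWaveOrderParameter U μ`
on some open sub-window for all small `U` — implies `CwChiralConstruction`. Proof: clause (i) ⟹ point datum ⟹
(`stub_klLeadingMuWindowOfPoint`, p141740) a level window with certified fillings in `(13/25, 7/10)`, placed inside
`[-2, -3/10]` by `n(-2) ≤ 1/2`, `7/10 ≤ n(-3/10)` and the monotone free filling; the mechanism gives the floor on an open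
sub-window; c1's frame `cwChiralConstruction_of_orderOnOpenSet` concludes. [cite: KohnLuttinger1965]
[cite: RaghuKivelsonScalapino2010, §II (7), (13)] -/
theorem cwChiralConstruction_of_cwKLChiralWindow_of_klMechanism (hW : CwKLChiralWindow)
    (hKL : ∀ μ₁ μ₂ γ U₁ : ℝ, -2 ≤ μ₁ → μ₁ < μ₂ → μ₂ ≤ -(3:ℝ) / 10 → 0 < γ → 0 < U₁ →
      (∀ U ∈ Set.Ioo (0:ℝ) U₁, ∀ μ ∈ Set.Icc μ₁ μ₂, ∀ χ : D4Irrep, χ ≠ D4Irrep.B1g →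
        channelInf (squareDispersion 1 0) μ U D4Irrep.B1g + γ * U ^ 2 ≤ channelInf (squareDispersion 1 0) μ U χ) →
      ∃ μ₁' μ₂' U₀ C : ℝ, μ₁ ≤ μ₁' ∧ μ₁' < μ₂' ∧ μ₂' ≤ μ₂ ∧ 0 < U₀ ∧ 0 < C ∧
        ∀ U ∈ Set.Ioo (0:ℝ) U₀, ∀ μ ∈ Set.Ioo μ₁' μ₂', Real.exp (-C / U ^ 2) ≤ dWaveOrderParameter U μ) :
    CwChiralConstruction := by
  obtain ⟨μ₁, μ₂, γ, U₁, h4, h12, h0, hγ, hU₁, hn₁, hn₂, hK⟩ :=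
    stub_klLeadingMuWindowOfPoint (klLeadingAtWindowDoping_of_cwKLChiralWindow' hW)
  -- the certified fillings place the window inside `[-2, -3/10]`
  have hμ₁ : -2 ≤ μ₁ := by
    by_contra hlt
    have hlt : μ₁ < -2 := not_le.mp hlt
    have := monotone_filling hlt.le
    linarith [filling_neg_two_le_half']
  have hμ₂ : μ₂ ≤ -(3:ℝ) / 10 := by
    by_contra hlt
    have hlt : -(3:ℝ) / 10 < μ₂ := not_le.mp hlt
    have := monotone_filling hlt.le
    linarith [stub_fillingAtNegThreeTenths]
  obtain ⟨μ₁', μ₂', U₀, C, h1', h12', h2', hU₀, hC, hfloor⟩ := hKL μ₁ μ₂ γ U₁ hμ₁ h12 hμ₂ hγ hU₁ hK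
  -- the sub-window inherits the certified fillings
  set η : ℝ := min (KohnLuttinger.filling (squareDispersion 1 0) μ₁ - 13 / 25)
    (7 / 10 - KohnLuttinger.filling (squareDispersion 1 0) μ₂) with hηdef
  have hη : 0 < η := lt_min (by linarith) (by linarith)
  have hη₁ : η ≤ KohnLuttinger.filling (squareDispersion 1 0) μ₁ - 13 / 25 := min_le_left _ _
  have hη₂ : η ≤ 7 / 10 - KohnLuttinger.filling (squareDispersion 1 0) μ₂ := min_le_right _ _
  refine cwChiralConstruction_of_orderOnOpenSet ⟨η, U₀, C, hη, hU₀, hC, fun U hU => ?_⟩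
  refine ⟨μ₁', μ₂', h12', fun μ hμ => ?_, fun μ hμ => hfloor U hU μ hμ⟩
  have hm1 : KohnLuttinger.filling (squareDispersion 1 0) μ₁ ≤
      KohnLuttinger.filling (squareDispersion 1 0) μ := monotone_filling (h1'.trans hμ.1)
  have hm2 : KohnLuttinger.filling (squareDispersion 1 0) μ ≤
      KohnLuttinger.filling (squareDispersion 1 0) μ₂ := monotone_filling (hμ.2.trans h2')
  exact ⟨by linarith, by linarith⟩

/-- **Registered sub-goal `stub_cruxOfChiralWindowAndKLMechanism`** (arrow form of
`cwChiralConstruction_of_cwKLChiralWindow_of_klMechanism`, line `ladder-scale-transfer` rev c5-2): the kill switch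
`CwKLChiralWindow` and the Kohn–Luttinger mechanism in local uniform form imply `CwChiralConstruction`.
[cite: KohnLuttinger1965] -/
theorem stub_cruxOfChiralWindowAndKLMechanism :
    CwKLChiralWindow → (∀ μ₁ μ₂ γ U₁ : ℝ, -2 ≤ μ₁ → μ₁ < μ₂ → μ₂ ≤ -(3:ℝ) / 10 → 0 < γ → 0 < U₁ → (∀ U ∈ Set.Ioo (0:ℝ) U₁, ∀ μ ∈ Set.Icc μ₁ μ₂, ∀ χ : D4Irrep, χ ≠ D4Irrep.B1g → channelInf (squareDispersion 1 0) μ U D4Irrep.B1g + γ * U ^ 2 ≤ channelInf (squareDispersion 1 0) μ U χ) → ∃ μ₁' μ₂' U₀ C : ℝ, μ₁ ≤ μ₁' ∧ μ₁' < μ₂' ∧ μ₂' ≤ μ₂ ∧ 0 < U₀ ∧ 0 < C ∧ ∀ U ∈ Set.Ioo (0:ℝ) U₀, ∀ μ ∈ Set.Ioo μ₁' μ₂', Real.exp (-C / U ^ 2) ≤ dWaveOrderParameter U μ) → CwChiralConstruction :=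
  fun hW hKL => cwChiralConstruction_of_cwKLChiralWindow_of_klMechanism hW hKL

/-! ### Appended (lead c5, rev c5-3): the bridge for the FULL-WINDOW (uniform) form of the mechanism — the statement registered for promotion -/

/-- **The crux from the kill switch and the Kohn–Luttinger mechanism in local UNIFORM (full-window) form.** `CwKLChiralWindow`
(stmt-1741) together with: on every level window `[μ₁, μ₂] ⊂ [-2, -3/10]` where `B₁g` leads by `γU²` for `U < U₁`, an order floor
`e^{-C/U²} ≤ dWaveOrderParameter U μ` on ALL operator levels `μ ∈ [μ₁ + U/2, μ₂]` for `U < U₀` — the registered stub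
`stub_dWaveOrderFloorOnLeadingWindows` of line `ladder-scale-transfer` rev c5-3, of which crux stmt-2010's merged stub
`stub_dWaveOrderFloorOnWindow` is the instance `[-9/10, -3/10]` — implies `CwChiralConstruction`. Reduction to the sub-window form: for
`U < min U₀ (μ₂ - μ₁)` the half-window `((μ₁+μ₂)/2, μ₂)` lies in `[μ₁ + U/2, μ₂]`. [cite: KohnLuttinger1965]
[cite: RaghuKivelsonScalapino2010, §II (7), (13)] -/
theorem cwChiralConstruction_of_cwKLChiralWindow_of_leadingWindowsFloor (hW : CwKLChiralWindow)
    (hM : ∀ μ₁ μ₂ γ U₁ : ℝ, -2 ≤ μ₁ → μ₁ < μ₂ → μ₂ ≤ -(3:ℝ) / 10 → 0 < γ → 0 < U₁ →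
      (∀ U ∈ Set.Ioo (0:ℝ) U₁, ∀ μ ∈ Set.Icc μ₁ μ₂, ∀ χ : D4Irrep, χ ≠ D4Irrep.B1g →
        channelInf (squareDispersion 1 0) μ U D4Irrep.B1g + γ * U ^ 2 ≤ channelInf (squareDispersion 1 0) μ U χ) →
      ∃ U₀ C : ℝ, 0 < U₀ ∧ 0 < C ∧ ∀ U ∈ Set.Ioo (0:ℝ) U₀, ∀ μ ∈ Set.Icc (μ₁ + U / 2) μ₂,
        Real.exp (-C / U ^ 2) ≤ dWaveOrderParameter U μ) :
    CwChiralConstruction := by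
  refine cwChiralConstruction_of_cwKLChiralWindow_of_klMechanism hW
    fun μ₁ μ₂ γ U₁ hμ₁ h12 hμ₂ hγ hU₁ hK => ?_
  obtain ⟨U₀, C, hU₀, hC, H⟩ := hM μ₁ μ₂ γ U₁ hμ₁ h12 hμ₂ hγ hU₁ hK
  refine ⟨(μ₁ + μ₂) / 2, μ₂, min U₀ (μ₂ - μ₁), C, by linarith, by linarith, le_rfl, lt_min hU₀ (by linarith), hC,
    fun U hU μ hμ => ?_⟩
  have hUU₀ : U < U₀ := lt_of_lt_of_le hU.2 (min_le_left _ _)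
  have hUw : U < μ₂ - μ₁ := lt_of_lt_of_le hU.2 (min_le_right _ _)
  exact H U ⟨hU.1, hUU₀⟩ μ ⟨by linarith [hμ.1], hμ.2.le⟩

/-- **Registered sub-goal `stub_cruxOfChiralWindowAndLeadingWindowsFloor`** (arrow form; the conditional bridge for the item recommended
for promotion): `CwKLChiralWindow` and the registered research stub (M) `stub_dWaveOrderFloorOnLeadingWindows` (Kohn–Luttinger mechanism,
local uniform form) imply `CwChiralConstruction`. [cite: KohnLuttinger1965] -/
theorem stub_cruxOfChiralWindowAndLeadingWindowsFloor :
    CwKLChiralWindow → (∀ μ₁ μ₂ γ U₁ : ℝ, -2 ≤ μ₁ → μ₁ < μ₂ → μ₂ ≤ -(3:ℝ) / 10 → 0 < γ → 0 < U₁ → (∀ U ∈ Set.Ioo (0:ℝ) U₁, ∀ μ ∈ Set.Icc μ₁ μ₂, ∀ χ : D4Irrep, χ ≠ D4Irrep.B1g → channelInf (squareDispersion 1 0) μ U D4Irrep.B1g + γ * U ^ 2 ≤ channelInf (squareDispersion 1 0) μ U χ) → ∃ U₀ C : ℝ, 0 < U₀ ∧ 0 < C ∧ ∀ U ∈ Set.Ioo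 (0:ℝ) U₀, ∀ μ ∈ Set.Icc (μ₁ + U / 2) μ₂, Real.exp (-C / U ^ 2) ≤ dWaveOrderParameter U μ) → CwChiralConstruction :=
  fun hW hM => cwChiralConstruction_of_cwKLChiralWindow_of_leadingWindowsFloor hW hM

end Summit.HubbardSuperconductivity.HubbardSuperconductivity.Theorems
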